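import Summits.QuantumFields.GaugeBoot.SU2WeakCouplingRateUniform
import Summits.QuantumFields.GaugeBoot.LimitPoints
import HarnessLib

/-!
# Gauge-boot: the uniform `SU(2)` weak-coupling rate passes to every infinite-volume limit point
# (large-`N` supplement 17, part 11)

HONEST FRAMING (cell `pub-gaugeboot`, page 1 of every file): certified bounds on lattice
expectations at STATED coupling, gauge group, dimension and torus size; NOT a mass gap, NOT a
continuum limit, NOT a string tension, NOT large `N`; NOT Yang–Mills-summit-bearing (barriers
`FixedCouplingUltralocality`, `PerturbativeInvisibility`).  An asymptotic statement at weak coupling; no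
uniqueness of the infinite-volume limit is claimed and no number of the cell's tables is certified.

## Content

Part 10's bound `1 − plaquetteExpectation 2 D L β_std ≤ 2(1 + (2/(D−1))(log 4096 + 2 log(β_std/2)))/β_std`
holds for EVERY torus side `L`, so it survives the thermodynamic limit: for every infinite-volume limit
point `μ` of the `SU(2)` torus Wilson states at `β_std ≥ 2` (tree notion `infiniteVolumeLimitPoints`,
any subsequence of torus sizes, `D ≥ 2`) and every plaquette `(x; i ≠ j)` of `ℤ^D`:

* ★★★ `one_sub_integral_plaquette_le_of_mem_limitPoints` —
  `1 − ∫ (1/2) Re tr U_P dμ ≤ 2·(1 + (2/(D−1))·(log 4096 + 2·log(β_std/2)))/β_std`.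

With supplement 16 (`DLRWilsonLoopStrict`: `∫ W dμ < 1`) and A17 this brackets the infinite-volume
plaquette of `SU(2)` at weak coupling between `1 − O(log β/β)` and `1`.  [folklore]
-/

noncomputable section

open MeasureTheory Filter Topology
open Literature.MathematicalPhysics.QuantumFieldTheory
open Literature.MathematicalPhysics.QuantumLattice (LGConfig plaquetteObs plaquetteHolonomyZd IsCylinder
  IsInfiniteVolumeLimitAlong infiniteVolumeLimitPoints fundamentalRep_apply)
open Literature.RepresentationTheory.CompactGroups

namespace Summit.QuantumFields.GaugeBoot

namespace SU2Rate

variable {D : ℕ}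

/-- ★★★ **The uniform weak-coupling rate at every infinite-volume limit point.**  For `SU(2)`, `D ≥ 2`,
`β_std ≥ 2`, every `μ ∈ infiniteVolumeLimitPoints (suRep 2) (β_std/2)` and every plaquette `(x; i ≠ j)`
of `ℤ^D`: `1 − ∫ (1/2) Re tr U_P dμ ≤ 2(1 + (2/(D−1))(log 4096 + 2 log(β_std/2)))/β_std`. [folklore] -/
theorem one_sub_integral_plaquette_le_of_mem_limitPoints (hD : 2 ≤ D) {β : ℝ} (hβ : 2 ≤ β)
    {μ : Measure (LGConfig D (SU 2))} (hμ : μ ∈ infiniteVolumeLimitPoints (d := D) (suRep 2) (β / 2))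
    (x : Literature.Probability.LatticeModels.Site D) {i j : Fin D} (hij : i ≠ j) :
    1 - ∫ U, (2 : ℝ)⁻¹ * plaquetteObs (suRep 2) x i j U ∂μ ≤
      2 * (1 + 2 / ((D : ℝ) - 1) * (Real.log 4096 + 2 * Real.log (β / 2))) / β := by
  obtain ⟨Lk, hmono, hlim⟩ := hμ
  set F : LGConfig D (SU 2) → ℝ := fun U => (2 : ℝ)⁻¹ * plaquetteObs (suRep 2) x i j U with hF
  have hcyl : IsCylinder F ({(x, i), (x + Pi.single i 1, j), (x + Pi.single j 1, i), (x, j)} :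
      Finset (Literature.MathematicalPhysics.QuantumLattice.ZdEdge D)) := by
    intro U V hUV
    simp only [hF, plaquetteObs, plaquetteHolonomyZd]
    rw [hUV (x, i) (by simp), hUV (x + Pi.single i 1, j) (by simp), hUV (x + Pi.single j 1, i) (by simp),
      hUV (x, j) (by simp)]
  have hcont : Continuous F := by
    have h1 : Continuous fun U : LGConfig D (SU 2) => plaquetteHolonomyZd U x i j := by
      unfold plaquetteHolonomyZd; fun_prop
    exact continuous_const.mul ((continuous_trace_re (suRep 2) (continuous_suRep 2)).comp h1)
  have hbd : ∃ C, ∀ U, |F U| ≤ C := by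
    refine ⟨1, fun U => ?_⟩
    have h := CompactGroup.abs_re_trace_le_card (suRep 2) (continuous_suRep 2) (plaquetteHolonomyZd U x i j)
    rw [Fintype.card_fin] at h
    simp only [hF, plaquetteObs]
    rw [abs_mul, abs_inv, Nat.abs_ofNat]
    calc (2 : ℝ)⁻¹ * |((suRep 2) (plaquetteHolonomyZd U x i j)).trace.re| ≤ (2 : ℝ)⁻¹ * 2 := by gcongr; exact_mod_cast h
      _ = 1 := by norm_num
  have htend := hlim.2 F _ hcyl hcont hbd
  have hFt : ∀ L : ℕ, Literature.MathematicalPhysics.QuantumLattice.toTorusObservable L F =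
      plaquetteTrace (suRep 2) (Literature.Probability.LatticeModels.Torus.proj L x) i j := fun L => by
    have h := toTorusObservable_plaquetteObs (N := 2) (suRep 2) L x i j
    simpa [hF] using h
  simp only [hFt] at htend
  -- on every torus the single-plaquette expectation is the mean plaquette, bounded below uniformly in `L`
  have hev : ∀ k : ℕ, 1 - 2 * (1 + 2 / ((D : ℝ) - 1) * (Real.log 4096 + 2 * Real.log (β / 2))) / β ≤
      wilsonExpectation (suRep 2) (β / 2)
        (plaquetteTrace (suRep 2) (Literature.Probability.LatticeModels.Torus.proj (Lk k + 1) x) i j) := by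
    intro k
    have h := one_sub_plaquetteExpectation_two_le_uniform (D := D) (L := Lk k + 1) hD hβ
    unfold plaquetteExpectation at h
    rw [Nat.cast_ofNat, wilsonExpectation_meanPlaquette_eq_plaquetteTrace (suRep 2) (continuous_suRep 2) (β / 2)
      (Literature.Probability.LatticeModels.Torus.proj (Lk k + 1) x) hij] at h
    linarith
  have hge := ge_of_tendsto htend (Filter.Eventually.of_forall hev)
  linarith

/-- The same with the lane's `ℤ^d` word loop variable of the plaquette word is immediate from
`wordHolonomyZd_plaquette`; here the statement for the torus-free formulation used by Class-B states:
for every Class-B state of `SU(2)` in `D ≥ 2` dimensions at `β_std ≥ 2` that IS a limit point, the bound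
holds (restatement for `IsInfiniteVolumeLimitAlong` along any strictly increasing sequence). [folklore] -/
theorem one_sub_integral_plaquette_le_of_limitAlong (hD : 2 ≤ D) {β : ℝ} (hβ : 2 ≤ β) {Lk : ℕ → ℕ}
    (hmono : StrictMono Lk) {μ : Measure (LGConfig D (SU 2))} (hμ : IsInfiniteVolumeLimitAlong (suRep 2) (β / 2) Lk μ)
    (x : Literature.Probability.LatticeModels.Site D) {i j : Fin D} (hij : i ≠ j) :
    1 - ∫ U, (2 : ℝ)⁻¹ * plaquetteObs (suRep 2) x i j U ∂μ ≤
      2 * (1 + 2 / ((D : ℝ) - 1) * (Real.log 4096 + 2 * Real.log (β / 2))) / β :=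
  one_sub_integral_plaquette_le_of_mem_limitPoints hD hβ ⟨Lk, hmono, hμ⟩ x hij

end SU2Rate

end Summit.QuantumFields.GaugeBoot

end
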